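import Mathlib
import Literature.NumberTheory.Transcendental.SemialgebraicMaps
import Summits.KontsevichZagierPeriods.KontsevichZagierPeriods.Theorems.SoloInformedPolyJacobian
import HarnessLib
import HarnessLib.Audit

/-!
# SoloInformed — rational maps: symbolic Jacobians for move (2) of the KZ calculus

Companion of `SoloInformedPolyJacobian`: for tuples of quotients `Pⱼ/Qⱼ` of polynomials with
rational coefficients, the map `x ↦ (Pⱼ(x)/Qⱼ(x))ⱼ` is `ℚ`-semialgebraic where the `Qⱼ` do not
vanish, differentiable there with the quotient-rule Jacobian, and the Jacobian determinant is the
determinant of the evaluated quotient-rule matrix. This is the regularity package that rule (2)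
(`KZ.changeOfVariablesRel`) asks of a rational (not merely polynomial) algebraic change of
variables. Used by `SoloInformedCalabiMap` / `SoloInformedZetaTwo` (Euler's identity
`ζ(2) = π²/6` inside the calculus).

Residency `solo-KontsevichZagierPeriods-informed` (PLAN.md, session s17).
-/

noncomputable section

namespace Summit.KontsevichZagierPeriods.KontsevichZagierPeriods.Theorems

open Literature.NumberTheory.Transcendental MvPolynomial Set

variable {m k : ℕ}

/-- The rational map `x ↦ (Pⱼ(x) / Qⱼ(x))ⱼ`. -/
def soloInformedRatMap (P Q : Fin k → MvPolynomial (Fin m) ℚ) : (Fin m → ℝ) → (Fin k → ℝ) :=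
  fun x j => (aeval x (P j) : ℝ) / aeval x (Q j)

/-- Components of the rational map. -/
@[simp] theorem soloInformedRatMap_apply (P Q : Fin k → MvPolynomial (Fin m) ℚ) (x : Fin m → ℝ)
    (j : Fin k) : soloInformedRatMap P Q x j = (aeval x (P j) : ℝ) / aeval x (Q j) := rfl

/-- The quotient-rule Jacobian entry `∂ⱼᵢ = (Qⱼ ∂ᵢPⱼ − Pⱼ ∂ᵢQⱼ)/Qⱼ²` evaluated at `x`. -/
def soloInformedRatJacEntry (P Q : Fin k → MvPolynomial (Fin m) ℚ) (x : Fin m → ℝ) (j : Fin k)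
    (i : Fin m) : ℝ :=
  ((aeval x (Q j) : ℝ) * aeval x (pderiv i (P j)) - aeval x (P j) * aeval x (pderiv i (Q j))) /
    aeval x (Q j) ^ 2

/-- The Jacobian of the rational map at `x`, as a continuous linear map. -/
def soloInformedRatJacCLM (P Q : Fin k → MvPolynomial (Fin m) ℚ) (x : Fin m → ℝ) :
    (Fin m → ℝ) →L[ℝ] (Fin k → ℝ) :=
  ContinuousLinearMap.pi fun j =>
    ∑ i, soloInformedRatJacEntry P Q x j i • (ContinuousLinearMap.proj i : (Fin m → ℝ) →L[ℝ] ℝ)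

/-- Evaluation formula for the rational Jacobian. -/
@[simp] theorem soloInformedRatJacCLM_apply (P Q : Fin k → MvPolynomial (Fin m) ℚ)
    (x v : Fin m → ℝ) (j : Fin k) :
    soloInformedRatJacCLM P Q x v j = ∑ i, soloInformedRatJacEntry P Q x j i * v i := by
  simp [soloInformedRatJacCLM]

/-- **Quotient rule** for `P/Q` with the symbolic gradients of `SoloInformedPolyJacobian`. -/
theorem soloInformed_hasFDerivAt_aeval_div (P Q : MvPolynomial (Fin m) ℚ) (x : Fin m → ℝ)
    (hQ : (aeval x Q : ℝ) ≠ 0) :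
    HasFDerivAt (fun y : Fin m → ℝ => (aeval y P : ℝ) / aeval y Q)
      (∑ i, (((aeval x Q : ℝ) * aeval x (pderiv i P) - aeval x P * aeval x (pderiv i Q)) /
        aeval x Q ^ 2) • (ContinuousLinearMap.proj i : (Fin m → ℝ) →L[ℝ] ℝ)) x := by
  have hP := soloInformed_hasFDerivAt_aeval P x
  have hQ' := soloInformed_hasFDerivAt_aeval Q x
  have hinv := (hasFDerivAt_inv hQ).comp x hQ'
  have h := hP.mul hinv
  have hfun : (fun y : Fin m → ℝ => (aeval y P : ℝ) / aeval y Q) =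
      (fun y : Fin m → ℝ => (aeval y P : ℝ)) * ((fun t : ℝ => t⁻¹) ∘ fun y => (aeval y Q : ℝ)) := by
    funext y; simp [div_eq_mul_inv]
  rw [hfun]
  refine h.congr_fderiv ?_
  ext v
  have key : ∀ i ∈ (Finset.univ : Finset (Fin m)),
      (aeval x P : ℝ) * (aeval x (pderiv i Q) * v i * -(aeval x Q ^ 2)⁻¹) +
        (aeval x Q : ℝ)⁻¹ * (aeval x (pderiv i P) * v i) =
      ((aeval x Q : ℝ) * aeval x (pderiv i P) - aeval x P * aeval x (pderiv i Q)) /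
        aeval x Q ^ 2 * v i := by
    intro i _
    field_simp
    ring
  simp only [add_apply, smul_apply,
    ContinuousLinearMap.comp_apply, ContinuousLinearMap.toSpanSingleton_apply,
    soloInformedGradCLM_apply, smul_eq_mul, Function.comp_apply, FunLike.coe_sum,
    Finset.sum_apply, FunLike.coe_smul, Pi.smul_apply, ContinuousLinearMap.proj_apply,
    Finset.sum_mul, Finset.mul_sum, ← Finset.sum_add_distrib]
  exact Finset.sum_congr rfl key

/-- **Rational maps are differentiable with the quotient-rule Jacobian** (where the
denominators do not vanish). [folklore] -/
theorem soloInformed_hasFDerivAt_ratMap (P Q : Fin k → MvPolynomial (Fin m) ℚ) (x : Fin m → ℝ)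
    (hQ : ∀ j, (aeval x (Q j) : ℝ) ≠ 0) :
    HasFDerivAt (soloInformedRatMap P Q) (soloInformedRatJacCLM P Q x) x :=
  hasFDerivAt_pi.2 fun j => soloInformed_hasFDerivAt_aeval_div (P j) (Q j) x (hQ j)

/-- The rational Jacobian as the linear map of the evaluated quotient-rule matrix. -/
theorem soloInformed_ratJacCLM_eq_toLin' (P Q : Fin k → MvPolynomial (Fin m) ℚ) (x : Fin m → ℝ) :
    (soloInformedRatJacCLM P Q x : (Fin m → ℝ) →ₗ[ℝ] (Fin k → ℝ)) =
      Matrix.toLin' (Matrix.of (soloInformedRatJacEntry P Q x)) := by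
  refine LinearMap.ext fun v => funext fun j => ?_
  simp [Matrix.toLin'_apply, Matrix.mulVec, dotProduct]

/-- **The Jacobian determinant of a rational map is the determinant of the quotient-rule
matrix.** [folklore] -/
theorem soloInformed_det_ratJacCLM (P Q : Fin m → MvPolynomial (Fin m) ℚ) (x : Fin m → ℝ) :
    (soloInformedRatJacCLM P Q x).det = (Matrix.of (soloInformedRatJacEntry P Q x)).det := by
  rw [ContinuousLinearMap.det, soloInformed_ratJacCLM_eq_toLin', LinearMap.det_toLin']

/-- Rational maps are `ℚ`-semialgebraic on any `ℚ`-semialgebraic set avoiding the poles.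
[folklore] -/
theorem soloInformed_isSemialgebraicMapOn_ratMap {s : Set (Fin m → ℝ)}
    (hs : Literature.ModelTheory.ExponentialFields.IsSemialgebraic ℚ s)
    (P Q : Fin k → MvPolynomial (Fin m) ℚ) (hQ : ∀ j, ∀ x ∈ s, (aeval x (Q j) : ℝ) ≠ 0) :
    IsSemialgebraicMapOn ℚ s (soloInformedRatMap P Q) :=
  IsSemialgebraicMapOn.of_forall hs fun j => isSemialgebraicFunOn_aeval_div_aeval hs (P j) (Q j) (hQ j)

end Summit.KontsevichZagierPeriods.KontsevichZagierPeriods.Theorems
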